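import Summits.KontsevichZagierPeriods.KontsevichZagierPeriods.Theorems.HurwitzMicroSectorsNormalFormPrincipleLevelOne
import Summits.KontsevichZagierPeriods.KontsevichZagierPeriods.Theorems.HurwitzMicroSectorsNormalFormPrincipleDilogLayer
import Summits.KontsevichZagierPeriods.KontsevichZagierPeriods.Theorems.MzvKernelInKZ.Negative.ScalingDivision

/-!
# `NormalFormPrinciple` (stmt-KontsevichZagierPeriods-3869), line `SketchIdeator1` —
# leaf `stub_boxRigidity`, layer `Dilog`: the level-two boxes of dimension two join the level-one kernel

Pure proof file (lead seat c9; `--supports` the crux). The level-one layer proves Conjecture 1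
UNCONDITIONALLY (Lindemann) on the subgroup generated by the level-one boxes `[□², P/(1−xy)]`
(`P ∈ ℚ[x,y]`) and all rational polynomial boxes (`LevelOne.mem_relations_of_eval_eq_zero_of_mem_closure`,
values `ℚ + ℚπ²`). The dilogarithm layer of this line adds, still unconditionally, the LEVEL-TWO boxes
of dimension two whose values are rational multiples of `π²`:
`[□², 1/(1+xy)]` (`η(2) = π²/12`), `[□², 4xy/(1−x²y²)]` (`ζ(2)`), `[□², 1/(−1−xy)]` (`−π²/12`) —
each is congruent modulo `KZ.relations` to a level-one box `[□², β/(1−xy)]`, `β = 1/2, 1, −1/2`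
(`dilog_duplication` at `a = 1`, i.e. `Li₂(z) + Li₂(−z) = ½Li₂(z²)` read on boxes, the
`squares_substitution` chart, and division by `2` through the scaling move), so the extended subgroup
is contained in the level-one subgroup plus `relations`, on which a vanishing value already forces a
relation. References: M. Kontsevich, D. Zagier, *Periods* (2001), §1.2 (Conjecture 1); F. Lindemann (1882).
No definitions are introduced.
-/

noncomputable section

open MeasureTheory Set
open Literature.NumberTheory.Transcendental Literature.NumberTheory.Transcendental.KZ
open Literature.ModelTheory.ExponentialFields (IsSemialgebraic)
open Summit.KontsevichZagierPeriods.MzvKernelInKZ.Negative (mem_relations_of_nsmul_mem)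
open Summit.KontsevichZagierPeriods.HurwitzMicroSectors.NormalFormPrinciple.PiBox.LevelOne
  (exists_zetaTwoRep zetaTwoRep_add_mem_relations zetaTwoRep_congr_mem_relations
    mem_relations_of_eval_eq_zero_of_mem_closure)

namespace Summit.KontsevichZagierPeriods.HurwitzMicroSectors.NormalFormPrinciple.PiBox.Dilog

/-- **`2[□², 1/(1+xy)] ≡ [□², 1/(1−xy)]` in the calculus** (`η(2) = ζ(2)/2`): the duplication
`Li₂(z) + Li₂(−z) = ½ Li₂(z²)` at `z = 1` on boxes (`dilog_duplication` with `a = 1`) and the sign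
flip `[□², 1/(1+xy)] + [□², 1/(−1−xy)] ∈ relations`. [cite: KontsevichZagier2001, §1.2 rules (1), (2)] -/
theorem dlk_two_etaTwo_sub_zetaTwo (N D : IntegralRep 2)
    (hNd : N.domain = {x | ∀ i, x i ∈ Set.Ioo (0:ℝ) 1}) (hNi : EqOn N.integrand (fun x => 1 / (1 + x 0 * x 1)) N.domain)
    (hDd : D.domain = {x | ∀ i, x i ∈ Set.Ioo (0:ℝ) 1}) (hDi : EqOn D.integrand (fun x => 1 / (1 - x 0 * x 1)) D.domain) :
    (2:ℕ) • of N - of D ∈ relations := by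
  obtain ⟨D', hD'd, hD'i⟩ := exists_dilogBox (a := (-1:ℝ)) (by
    simpa using isAlgebraic_one.neg) (Or.inr (by norm_num))
  have dup : of D - 2 • of D - 2 • of D' ∈ relations :=
    dilog_duplication (a := (1:ℝ)) isAlgebraic_one (by norm_num) D D D' hDd
      (fun x hx => by rw [hDi hx, one_pow]) hDd hDi hD'd (hD'i ▸ fun _ _ => rfl)
  have hneg : of N + of D' ∈ relations :=
    of_add_of_mem_relations_of_eqOn_neg (hD'd.trans hNd.symm) fun x hx => by
      simp only [hD'i, Pi.neg_apply, hNi hx]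
      rw [show (-1:ℝ) - x 0 * x 1 = -(1 + x 0 * x 1) by ring, div_neg_eq_neg_div]
  have e : (2:ℕ) • of N - of D = (2:ℕ) • (of N + of D') + (of D - 2 • of D - 2 • of D') := by
    abel
  rw [e]
  exact relations.add_mem (relations.nsmul_mem hneg 2) dup

/-- **The `η(2)` box is congruent to the level-one box `[□², (1/2)/(1−xy)]`** (division of
`dlk_two_etaTwo_sub_zetaTwo` by `2` through the scaling move). [cite: KontsevichZagier2001, §1.2] -/
theorem dlk_etaTwo_sub_half (N B : IntegralRep 2)
    (hNd : N.domain = {x | ∀ i, x i ∈ Set.Ioo (0:ℝ) 1}) (hNi : EqOn N.integrand (fun x => 1 / (1 + x 0 * x 1)) N.domain)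
    (hBd : B.domain = {x | ∀ i, x i ∈ Set.Ioo (0:ℝ) 1})
    (hBi : EqOn B.integrand (fun x => ((1/2 : ℚ) : ℝ) / (1 - x 0 * x 1)) B.domain) :
    of N - of B ∈ relations := by
  obtain ⟨D, hDd, hDi⟩ := exists_dilogBox (a := (1:ℝ)) isAlgebraic_one (Or.inl le_rfl)
  obtain ⟨B₁, hB₁d, hB₁i⟩ := exists_zetaTwoRep 1
  have h1 := dlk_two_etaTwo_sub_zetaTwo N D hNd hNi hDd (hDi ▸ fun _ _ => rfl)
  have h2 : of D - of B₁ ∈ relations :=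
    zetaTwoRep_congr_mem_relations (β := 1) D B₁ hDd (fun x _ => by rw [hDi]; push_cast; rfl)
      hB₁d hB₁i
  have h3 : of B₁ - of B - of B ∈ relations :=
    zetaTwoRep_add_mem_relations B₁ B B hB₁d (fun x hx => by rw [hB₁i hx]; norm_num) hBd hBi hBd hBi
  refine mem_relations_of_nsmul_mem (by norm_num : 0 < 2) ?_
  have e : (2:ℕ) • (of N - of B) = ((2:ℕ) • of N - of D) + (of D - of B₁) + (of B₁ - of B - of B) := by
    abel
  rw [e]
  exact relations.add_mem (relations.add_mem h1 h2) h3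

/-- **The squares box `[□², 4xy/(1−x²y²)]` is congruent to the level-one box `[□², 1/(1−xy)]`**
(the substitution `(x,y) ↦ (x², y²)`, `squares_substitution`). [cite: KontsevichZagier2001, §1.2 rule (2)] -/
theorem dlk_squares_sub_one (N B : IntegralRep 2)
    (hNd : N.domain = {x | ∀ i, x i ∈ Set.Ioo (0:ℝ) 1})
    (hNi : EqOn N.integrand (fun x => 4 * x 0 * x 1 / (1 - x 0 ^ 2 * x 1 ^ 2)) N.domain)
    (hBd : B.domain = {x | ∀ i, x i ∈ Set.Ioo (0:ℝ) 1})
    (hBi : EqOn B.integrand (fun x => ((1 : ℚ) : ℝ) / (1 - x 0 * x 1)) B.domain) :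
    of N - of B ∈ relations :=
  squares_substitution.1 1 B N hBd (fun x hx => by rw [hBi hx, one_pow]; push_cast; rfl) hNd
    (fun x hx => by rw [hNi hx, one_pow])

/-- **The `η(2)` box `[□², 1/(1 + xy)]` exists** (denominator `≥ 1`: bounded and continuous on
the closed square). [cite: KontsevichZagier2001, §1.1] -/
theorem dlk_exists_etaTwoBox :
    ∃ P : IntegralRep 2, P.domain = {x | ∀ i, x i ∈ Set.Ioo (0:ℝ) 1} ∧
      (P.integrand = fun x => 1 / (1 + x 0 * x 1)) := by
  have hB := isSemialgebraic_box 2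
  have hsa : IsSemialgebraicFunOn ℚ {x : Fin 2 → ℝ | ∀ i, x i ∈ Set.Ioo (0:ℝ) 1}
      (fun x => 1 / (1 + x 0 * x 1)) := by
    refine (isSemialgebraicFunOn_aeval_div_aeval hB (1 : MvPolynomial (Fin 2) ℚ)
      (1 + MvPolynomial.X 0 * MvPolynomial.X 1) fun x hx => ?_).congr fun x _ => ?_
    · simp only [map_add, map_one, map_mul, MvPolynomial.aeval_X]
      have h0 := (hx 0).1; have h1 := (hx 1).1
      positivity
    · simp only [map_add, map_one, map_mul, MvPolynomial.aeval_X]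
  have hint : IntegrableOn (fun x : Fin 2 → ℝ => 1 / (1 + x 0 * x 1))
      {x : Fin 2 → ℝ | ∀ i, x i ∈ Set.Ioo (0:ℝ) 1} := by
    have hc : ContinuousOn (fun x : Fin 2 → ℝ => 1 / (1 + x 0 * x 1)) (Set.Icc 0 1) :=
      continuousOn_const.div (by fun_prop) fun x hx => by
        have h0 : (0:ℝ) ≤ x 0 := hx.1 0
        have h1 : (0:ℝ) ≤ x 1 := hx.1 1
        positivity
    exact (hc.integrableOn_compact isCompact_Icc).mono_set
      fun x hx => ⟨fun i => (hx i).1.le, fun i => (hx i).2.le⟩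
  exact ⟨⟨_, _, hB, hsa, hint⟩, rfl, rfl⟩

/-- **The negative box `[□², 1/(−1−xy)]` is congruent to `−[□², (1/2)/(1−xy)]`.**
[cite: KontsevichZagier2001, §1.2] -/
theorem dlk_negBox_add_half (N B : IntegralRep 2)
    (hNd : N.domain = {x | ∀ i, x i ∈ Set.Ioo (0:ℝ) 1}) (hNi : EqOn N.integrand (fun x => 1 / (-1 - x 0 * x 1)) N.domain)
    (hBd : B.domain = {x | ∀ i, x i ∈ Set.Ioo (0:ℝ) 1})
    (hBi : EqOn B.integrand (fun x => ((1/2 : ℚ) : ℝ) / (1 - x 0 * x 1)) B.domain) :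
    of N + of B ∈ relations := by
  obtain ⟨P, hPd, hPi⟩ := dlk_exists_etaTwoBox
  have h1 : of P - of B ∈ relations := dlk_etaTwo_sub_half P B hPd (hPi ▸ fun _ _ => rfl) hBd hBi
  have h2 : of P + of N ∈ relations :=
    of_add_of_mem_relations_of_eqOn_neg (hNd.trans hPd.symm) fun x hx => by
      have hx' : x ∈ N.domain := by rw [hNd, ← hPd]; exact hx
      simp only [Pi.neg_apply, hPi, hNi hx']
      rw [show (-1:ℝ) - x 0 * x 1 = -(1 + x 0 * x 1) by ring, div_neg_eq_neg_div]
  have e : of N + of B = (of P + of N) - (of P - of B) := by abel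
  rw [e]
  exact relations.sub_mem h2 h1

/-- **Conjecture 1 UNCONDITIONALLY on the level-one boxes, the polynomial boxes, and the three
level-two boxes `[□², 1/(1+xy)]`, `[□², 4xy/(1−x²y²)]`, `[□², 1/(−1−xy)]`** (lead seat c9, line
`SketchIdeator1`, layer `Dilog`): a formal `ℤ`-combination of such representations with value `0` is
a Kontsevich–Zagier relation. The extended subgroup lies in the level-one subgroup plus `relations`
(the three congruences above), and there the level-one kernel theorem (Lindemann) applies.
[cite: KontsevichZagier2001, §1.2 Conjecture 1] -/
theorem dilogLevelOne_mem_relations_of_eval_eq_zero {c : FormalRep}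
    (hc : c ∈ AddSubgroup.closure
      ({y : FormalRep | ∃ (P : MvPolynomial (Fin 2) ℚ) (N : IntegralRep 2),
          N.domain = {x | ∀ i, x i ∈ Set.Ioo (0:ℝ) 1} ∧
          EqOn N.integrand (fun x => (MvPolynomial.aeval x P : ℝ) / (1 - x 0 * x 1)) N.domain ∧
          y = of N} ∪
       {y : FormalRep | ∃ (m : ℕ) (p : MvPolynomial (Fin m) ℚ) (N : IntegralRep m),
          N.domain = {x | ∀ i, x i ∈ Set.Ioo (0:ℝ) 1} ∧
          EqOn N.integrand (fun x => (MvPolynomial.aeval x p : ℝ)) N.domain ∧ y = of N} ∪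
       {y : FormalRep | ∃ N : IntegralRep 2, N.domain = {x | ∀ i, x i ∈ Set.Ioo (0:ℝ) 1} ∧
          EqOn N.integrand (fun x => 1 / (1 + x 0 * x 1)) N.domain ∧ y = of N} ∪
       {y : FormalRep | ∃ N : IntegralRep 2, N.domain = {x | ∀ i, x i ∈ Set.Ioo (0:ℝ) 1} ∧
          EqOn N.integrand (fun x => 4 * x 0 * x 1 / (1 - x 0 ^ 2 * x 1 ^ 2)) N.domain ∧ y = of N} ∪
       {y : FormalRep | ∃ N : IntegralRep 2, N.domain = {x | ∀ i, x i ∈ Set.Ioo (0:ℝ) 1} ∧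
          EqOn N.integrand (fun x => 1 / (-1 - x 0 * x 1)) N.domain ∧ y = of N}))
    (hv : eval c = 0) : c ∈ relations := by
  obtain ⟨B, hBd, hBi⟩ := exists_zetaTwoRep (1/2)
  obtain ⟨B₁, hB₁d, hB₁i⟩ := exists_zetaTwoRep 1
  have hBmem : of B ∈ AddSubgroup.closure ({y : FormalRep | ∃ (P : MvPolynomial (Fin 2) ℚ) (N : IntegralRep 2),
          N.domain = {x | ∀ i, x i ∈ Set.Ioo (0:ℝ) 1} ∧
          EqOn N.integrand (fun x => (MvPolynomial.aeval x P : ℝ) / (1 - x 0 * x 1)) N.domain ∧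
          y = of N} ∪
       {y : FormalRep | ∃ (m : ℕ) (p : MvPolynomial (Fin m) ℚ) (N : IntegralRep m),
          N.domain = {x | ∀ i, x i ∈ Set.Ioo (0:ℝ) 1} ∧
          EqOn N.integrand (fun x => (MvPolynomial.aeval x p : ℝ)) N.domain ∧ y = of N}) :=
    AddSubgroup.subset_closure (Or.inl ⟨MvPolynomial.C (1/2), B, hBd,
      fun x hx => by rw [hBi hx]; simp only [MvPolynomial.aeval_C, eq_ratCast], rfl⟩)
  have hB₁mem : of B₁ ∈ AddSubgroup.closure ({y : FormalRep | ∃ (P : MvPolynomial (Fin 2) ℚ) (N : IntegralRep 2),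
          N.domain = {x | ∀ i, x i ∈ Set.Ioo (0:ℝ) 1} ∧
          EqOn N.integrand (fun x => (MvPolynomial.aeval x P : ℝ) / (1 - x 0 * x 1)) N.domain ∧
          y = of N} ∪
       {y : FormalRep | ∃ (m : ℕ) (p : MvPolynomial (Fin m) ℚ) (N : IntegralRep m),
          N.domain = {x | ∀ i, x i ∈ Set.Ioo (0:ℝ) 1} ∧
          EqOn N.integrand (fun x => (MvPolynomial.aeval x p : ℝ)) N.domain ∧ y = of N}) :=
    AddSubgroup.subset_closure (Or.inl ⟨MvPolynomial.C 1, B₁, hB₁d,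
      fun x hx => by rw [hB₁i hx]; simp only [MvPolynomial.aeval_C, eq_ratCast], rfl⟩)
  -- the extended subgroup sits inside `level-one subgroup ⊔ relations`
  have hle : AddSubgroup.closure ({y : FormalRep | ∃ (P : MvPolynomial (Fin 2) ℚ) (N : IntegralRep 2),
          N.domain = {x | ∀ i, x i ∈ Set.Ioo (0:ℝ) 1} ∧
          EqOn N.integrand (fun x => (MvPolynomial.aeval x P : ℝ) / (1 - x 0 * x 1)) N.domain ∧
          y = of N} ∪
       {y : FormalRep | ∃ (m : ℕ) (p : MvPolynomial (Fin m) ℚ) (N : IntegralRep m),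
          N.domain = {x | ∀ i, x i ∈ Set.Ioo (0:ℝ) 1} ∧
          EqOn N.integrand (fun x => (MvPolynomial.aeval x p : ℝ)) N.domain ∧ y = of N} ∪
       {y : FormalRep | ∃ N : IntegralRep 2, N.domain = {x | ∀ i, x i ∈ Set.Ioo (0:ℝ) 1} ∧
          EqOn N.integrand (fun x => 1 / (1 + x 0 * x 1)) N.domain ∧ y = of N} ∪
       {y : FormalRep | ∃ N : IntegralRep 2, N.domain = {x | ∀ i, x i ∈ Set.Ioo (0:ℝ) 1} ∧
          EqOn N.integrand (fun x => 4 * x 0 * x 1 / (1 - x 0 ^ 2 * x 1 ^ 2)) N.domain ∧ y = of N} ∪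
       {y : FormalRep | ∃ N : IntegralRep 2, N.domain = {x | ∀ i, x i ∈ Set.Ioo (0:ℝ) 1} ∧
          EqOn N.integrand (fun x => 1 / (-1 - x 0 * x 1)) N.domain ∧ y = of N}) ≤
      AddSubgroup.closure ({y : FormalRep | ∃ (P : MvPolynomial (Fin 2) ℚ) (N : IntegralRep 2),
          N.domain = {x | ∀ i, x i ∈ Set.Ioo (0:ℝ) 1} ∧
          EqOn N.integrand (fun x => (MvPolynomial.aeval x P : ℝ) / (1 - x 0 * x 1)) N.domain ∧
          y = of N} ∪
       {y : FormalRep | ∃ (m : ℕ) (p : MvPolynomial (Fin m) ℚ) (N : IntegralRep m),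
          N.domain = {x | ∀ i, x i ∈ Set.Ioo (0:ℝ) 1} ∧
          EqOn N.integrand (fun x => (MvPolynomial.aeval x p : ℝ)) N.domain ∧ y = of N}) ⊔ relations := by
    refine (AddSubgroup.closure_le _).2 ?_
    rintro y (((hy | ⟨N, hNd, hNi, rfl⟩) | ⟨N, hNd, hNi, rfl⟩) | ⟨N, hNd, hNi, rfl⟩)
    · exact AddSubgroup.mem_sup_left (AddSubgroup.subset_closure hy)
    · have h := dlk_etaTwo_sub_half N B hNd hNi hBd hBi
      have e : of N = of B + (of N - of B) := by abel
      rw [e]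
      exact AddSubgroup.add_mem_sup hBmem h
    · have h := dlk_squares_sub_one N B₁ hNd hNi hB₁d hB₁i
      have e : of N = of B₁ + (of N - of B₁) := by abel
      rw [e]
      exact AddSubgroup.add_mem_sup hB₁mem h
    · have h := dlk_negBox_add_half N B hNd hNi hBd hBi
      have e : of N = -of B + (of N + of B) := by abel
      rw [e]
      exact AddSubgroup.add_mem_sup (AddSubgroup.neg_mem _ hBmem) h
  obtain ⟨a, ha, r, hr, rfl⟩ := AddSubgroup.mem_sup.1 (hle hc)
  have hr0 : eval r = 0 := relations_le_ker_eval_holds hr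
  have ha0 : eval a = 0 := by rw [map_add, hr0, add_zero] at hv; exact hv
  exact relations.add_mem (mem_relations_of_eval_eq_zero_of_mem_closure ha ha0) hr

end Summit.KontsevichZagierPeriods.HurwitzMicroSectors.NormalFormPrinciple.PiBox.Dilog
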